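import Summits.Parity.GeneralizedHardyLittlewood.Theorems.PolymathEpsThreeCeilingGridBoundHighRankActivityFibre

/-!
# Route `PolymathEpsThreeCeiling`, crux `GridBoundHigh` (stmt-Parity-19069): the FIVE-CONSTANT rank/activity
# certificates — parameter functions and their side conditions

The prover hand's numerics (item evidence `PARAMS-19069-rankactivity-5const.md`, `CENSUS-19069-orderone.md` §F6,
2026-08-31) certify every grid point `ε = j/80`, `17 ≤ j ≤ 40`, `Λ = 2(80+j)/(81+j)`, inside the rank/activity family
`RankActivity.weight` (files `…GridBoundHighRankActivity.lean`, `…RankActivityFibre.lean`) with parameter functions of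
`σ = ∑ t` built from FIVE CONSTANTS `(β, d₁₀, d₀, c)` and `Λ`:  on the zone `σ ≤ 3(1-ε)/2` (the only totals at which three
atoms can be active)
`β(σ) = β`, `d₁(σ) = d₁₀·(1 - σ⁺/S)`, `d₀(σ) = d₀`, `αS(σ) = (Λ - β σ⁺ - 2 d₁(σ) - d₀)/3` (`σ⁺ = max 0 σ`,
`S = min(2(1-ε), 1+ε)`), and harmless values off the zone; `c(σ) = c` everywhere (fibre-budget slack `0.95 %` at
`j = 40` … `2.5 %` at `j = 17`).  This file DEFINES these functions (`RankActivity.fiveB/fiveD1/fiveD0/fiveAS/fiveC`)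
and proves (`RankActivity.cwCert_of_fiveConst`) that the numeric side conditions
`1/5 ≤ ε < 1`, `0 < Λ`, `Λ/2 ≤ c < Λ`, `0 ≤ d₁₀`, `0 ≤ d₀`, `0 < β`, `2 d₁₀ + d₀ ≤ Λ`,
`β·(3(1-ε)/2) + 2 d₁₀ (1 - (3(1-ε)/2)/S) + d₀ ≤ Λ`
discharge ALL hypotheses of `RankActivity.cwCert_of_rankActivity` except the fibre budget `H`, which is passed through
verbatim.  Hence, for each `j`, the body of `stub_cwCertsHigh` follows from eight `norm_num` facts about the tabulated
constants and ONE analytic inequality (`H`: a two-parameter family of integrals over `(0, 1+ε-s₀-s₁]` of the reciprocal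
of a function that is affine on at most three sub-intervals and constant on at most three more).
Support lemmas for stmt-Parity-19069 only; no summit claim.  Standard axioms.
-/

noncomputable section

open Finset MeasureTheory Set

namespace Summit.Parity.GeneralizedHardyLittlewood.Theses.PolymathEpsThreeCeiling

namespace RankActivity

/-- `S = min(2(1-ε), 1+ε)`: beyond `σ = S` at most one atom is active (resp. the simplex ends). -/
def fiveS (ε : ℝ) : ℝ := min (2 * (1 - ε)) (1 + ε)

/-- The A=2 larger-atom weight: the constant `c`. -/
def fiveC (c : ℝ) : ℝ → ℝ := fun _ => c

/-- The strict-maximum increment `d₀` (three-active zone), `0` off the zone. -/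
def fiveD0 (ε d₀ : ℝ) : ℝ → ℝ := fun σ => if σ ≤ 3 * (1 - ε) / 2 then d₀ else 0

/-- The non-minimum increment `d₁(σ) = d₁₀ (1 - σ⁺/S)` on the three-active zone, `0` off it. -/
def fiveD1 (ε d₁₀ : ℝ) : ℝ → ℝ :=
  fun σ => if σ ≤ 3 * (1 - ε) / 2 then d₁₀ * (1 - max 0 σ / fiveS ε) else 0

/-- The common slope `β` on the three-active zone; `Λ / max σ 1` off it (keeps flatness and positivity). -/
def fiveB (ε Λ β : ℝ) : ℝ → ℝ := fun σ => if σ ≤ 3 * (1 - ε) / 2 then β else Λ / max σ 1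

/-- The smallest-atom intercept `αS(σ) = (Λ - β σ⁺ - 2 d₁(σ) - d₀)/3` on the zone (flatness tight), `0` off it. -/
def fiveAS (ε Λ β d₁₀ d₀ : ℝ) : ℝ → ℝ :=
  fun σ => if σ ≤ 3 * (1 - ε) / 2 then
    (Λ - β * max 0 σ - 2 * (d₁₀ * (1 - max 0 σ / fiveS ε)) - d₀) / 3 else 0

/-- `{σ | σ ≤ a}` is measurable. -/
private theorem measurableSet_le_const (a : ℝ) : MeasurableSet {σ : ℝ | σ ≤ a} :=
  measurableSet_le measurable_id measurable_const

/-- Measurability of the five parameter functions. -/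
theorem measurable_five (ε Λ β d₁₀ d₀ c : ℝ) :
    Measurable (fiveC c) ∧ Measurable (fiveAS ε Λ β d₁₀ d₀) ∧ Measurable (fiveD1 ε d₁₀) ∧
      Measurable (fiveD0 ε d₀) ∧ Measurable (fiveB ε Λ β) := by
  have hmax : Measurable fun σ : ℝ => max 0 σ := measurable_const.max measurable_id
  refine ⟨measurable_const, ?_, ?_, ?_, ?_⟩
  · exact Measurable.ite (measurableSet_le_const _)
      ((((measurable_const.sub (hmax.const_mul β)).sub
        ((measurable_const.sub (hmax.div_const _)).const_mul _ |>.const_mul 2)).sub measurable_const).div_const 3)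
      measurable_const
  · exact Measurable.ite (measurableSet_le_const _)
      ((measurable_const.sub (hmax.div_const _)).const_mul _) measurable_const
  · exact Measurable.ite (measurableSet_le_const _) measurable_const measurable_const
  · exact Measurable.ite (measurableSet_le_const _) measurable_const
      (measurable_const.div (measurable_id.max measurable_const))

/-- **The five-constant certificates, assembled.**  Numeric side conditions on `(ε, Λ, β, d₁₀, d₀, c)` plus the
fibre budget `H` for the explicit profile give the body of `stub_cwCertsHigh` at `(ε, Λ)`. -/
theorem cwCert_of_fiveConst {ε Λ β d₁₀ d₀ c : ℝ} (hε : 1 / 5 ≤ ε) (hε1 : ε < 1) (hΛ : 0 < Λ)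
    (hc1 : Λ / 2 ≤ c) (hc2 : c < Λ) (hd1 : 0 ≤ d₁₀) (hd0 : 0 ≤ d₀) (hβ : 0 < β)
    (h1 : 2 * d₁₀ + d₀ ≤ Λ)
    (h2 : β * (3 * (1 - ε) / 2) + 2 * (d₁₀ * (1 - (3 * (1 - ε) / 2) / fiveS ε)) + d₀ ≤ Λ)
    (H : ∀ s₀ s₁ : ℝ, 0 ≤ s₀ → 0 ≤ s₁ → s₀ + s₁ ≤ 1 - ε →
      ∫⁻ u in Ioc (0:ℝ) (1 + ε - (s₀ + s₁)),
        ENNReal.ofReal (fibreWeight ε Λ (fiveC c) (fiveAS ε Λ β d₁₀ d₀) (fiveD1 ε d₁₀) (fiveD0 ε d₀)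
          (fiveB ε Λ β) s₀ s₁ u)⁻¹ ≤ 1) :
    ∃ w : Fin 3 → (Fin 3 → ℝ) → ℝ, (∀ m, Measurable (w m)) ∧
      (∀ m (t : Fin 3 → ℝ), 0 < t m → ∑ i ∈ univ.erase m, t i ≤ 1 - ε → 0 < w m t) ∧
      (∀ m (s : Fin 2 → ℝ), (∀ i, 0 ≤ s i) → ∑ i, s i ≤ 1 - ε →
        ∫⁻ u in Ioc (0:ℝ) (1 + ε - ∑ i, s i), ENNReal.ofReal (w m (Fin.insertNth m u s))⁻¹ ≤ 1) ∧
      (∀ t : Fin 3 → ℝ, (∀ i, 0 ≤ t i) → ∑ i, t i ≤ 1 + ε →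
        ∑ m, (if 0 < t m ∧ ∑ i ∈ univ.erase m, t i ≤ 1 - ε then w m t else 0) ≤ Λ) := by
  obtain ⟨mc, mαS, md₁, md₀, mβ⟩ := measurable_five ε Λ β d₁₀ d₀ c
  -- the zone bound `M = 3(1-ε)/2` lies in `[0, S]` because `ε ≥ 1/5`
  set M : ℝ := 3 * (1 - ε) / 2 with hM
  have hM0 : 0 < M := by rw [hM]; linarith
  have hS : M ≤ fiveS ε := by
    rw [hM, fiveS]; refine le_min ?_ ?_ <;> linarith
  have hSpos : 0 < fiveS ε := hM0.trans_le hS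
  -- the linear function `f x = Λ - β x - 2 d₁₀ (1 - x/S) - d₀` is `≥ 0` on `[0, M]`
  have hlin : ∀ x : ℝ, 0 ≤ x → x ≤ M → 0 ≤ Λ - β * x - 2 * (d₁₀ * (1 - x / fiveS ε)) - d₀ := by
    intro x hx0 hxM
    have e : Λ - β * x - 2 * (d₁₀ * (1 - x / fiveS ε)) - d₀ =
        (1 - x / M) * (Λ - 2 * d₁₀ - d₀) +
          (x / M) * (Λ - β * M - 2 * (d₁₀ * (1 - M / fiveS ε)) - d₀) := by
      field_simp; ring
    rw [e]
    have hxM' : x / M ≤ 1 := (div_le_one hM0).2 hxM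
    have := mul_nonneg (sub_nonneg.2 hxM') (by linarith : (0:ℝ) ≤ Λ - 2 * d₁₀ - d₀)
    have := mul_nonneg (div_nonneg hx0 hM0.le)
      (by linarith : (0:ℝ) ≤ Λ - β * M - 2 * (d₁₀ * (1 - M / fiveS ε)) - d₀)
    linarith
  refine cwCert_of_rankActivity (c := fiveC c) (αS := fiveAS ε Λ β d₁₀ d₀) (d₁ := fiveD1 ε d₁₀)
    (d₀ := fiveD0 ε d₀) (β := fiveB ε Λ β) hΛ (fun _ => hc1) (fun _ => hc2) ?_ ?_ ?_ ?_ ?_ mc mαS md₁ md₀ mβ H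
  · -- `αS ≥ 0`
    intro σ; simp only [fiveAS]
    split_ifs with hz
    · have hx0 : 0 ≤ max 0 σ := le_max_left _ _
      have hxM : max 0 σ ≤ M := max_le hM0.le hz
      have := hlin (max 0 σ) hx0 hxM
      linarith
    · exact le_rfl
  · -- `d₁ ≥ 0`
    intro σ; simp only [fiveD1]
    split_ifs with hz
    · have hxM : max 0 σ ≤ fiveS ε := (max_le hM0.le hz).trans hS
      exact mul_nonneg hd1 (sub_nonneg.2 ((div_le_one hSpos).2 hxM))
    · exact le_rfl
  · -- `d₀ ≥ 0`
    intro σ; simp only [fiveD0]; split_ifs <;> [exact hd0; exact le_rfl]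
  · -- `β > 0`
    intro σ; simp only [fiveB]
    split_ifs with hz
    · exact hβ
    · exact div_pos hΛ (lt_of_lt_of_le zero_lt_one (le_max_right _ _))
  · -- flatness `3 αS + β σ + 2 d₁ + d₀ ≤ Λ`
    intro σ; simp only [fiveAS, fiveB, fiveD1, fiveD0]
    split_ifs with hz
    · have hσ : σ ≤ max 0 σ := le_max_right _ _
      nlinarith [hβ, hσ]
    · have h1' : σ / max σ 1 ≤ 1 := by
        rcases le_or_gt σ 1 with h | h
        · rw [max_eq_right h]; simpa using h
        · rw [max_eq_left h.le, div_self (by linarith : σ ≠ 0)]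
      have : Λ / max σ 1 * σ = Λ * (σ / max σ 1) := by ring
      rw [this]; nlinarith [hΛ, h1']

end RankActivity

end Summit.Parity.GeneralizedHardyLittlewood.Theses.PolymathEpsThreeCeiling

end
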